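import Mathlib.NumberTheory.NumberField.Basic
import Mathlib.NumberTheory.RamificationInertia.Ramification
import Mathlib.RingTheory.RamificationInertia.Ramification
import Mathlib.RingTheory.Ideal.Quotient.HasFiniteQuotients
import HarnessLib

/-!
# If `H(∛u)/H` is unramified at a prime `𝔓 ∣ 3` with `3 ∈ 𝔓²`, then `u` is a cube modulo `𝔓³`
# (Hecke, *Lectures on the Theory of Algebraic Numbers*, §39, Thm 119 — necessity half for `ℓ = 3`)

Topic `NumberTheory/NumberFields`.  Theorem-only file (no definition, no named fact), the converse
companion of `KummerCubeRootUnramified.lean` (sufficiency: `u ≡ 1 (mod λ³)` ⇒ `H(∛u)/H` unramified).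

Hecke, *Lectures on the Theory of Algebraic Numbers* (GTM 77), §39, Thm 119, for `k ∋ ζ = ζ_ℓ`, a
prime `𝔩 ∣ ℓ` with `𝔩^a ‖ (1 − ζ)` and `μ` prime to `𝔩`: in `K = k(ℓ√μ)` the prime `𝔩` "becomes the
`ℓ`th power of a prime ideal" if the congruence `μ ≡ ξ^ℓ (mod 𝔩^{aℓ})` (83) is unsolvable; i.e.
(contrapositive) **if `𝔩` is unramified in `k(ℓ√μ)` then `μ ≡ ξ^ℓ (mod 𝔩^{aℓ})` is solvable**.
Here `ℓ = 3`, `a = 1` in the weak form `3 ∈ 𝔓²` (i.e. `e(𝔓 ∣ 3) ≥ 2`, which is what `a ≥ 1` gives: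
`(1 − ζ)² (1 + ζ) = 3`), modulus `𝔓³`.

The proof is the standard three-line local computation (e.g. Washington, *Introduction to
Cyclotomic Fields*, Exercise 9.3; Cohen, *Advanced Topics*, Thm 10.2.9 for the general statement):
let `𝔔 ∣ 𝔓` in `E = H(y)`, `y³ = u`.  The residue field `𝓞_H/𝔓` is finite of characteristic `3`,
so cubing is a bijection on it and `u ≡ ξ³ (mod 𝔓)` for some `ξ ∈ 𝓞_H`; cubing is injective on
`𝓞_E/𝔔`, so `y ≡ ξ (mod 𝔔)`; then

  `u − ξ³ = y³ − ξ³ = (y − ξ)³ + 3ξ(y − ξ)² + 3ξ²(y − ξ) ∈ 𝔔³`   (as `3 ∈ 𝔓² ⊆ 𝔔²`),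

and if `e(𝔔 ∣ 𝔓) = 1` then `𝔔³ ∩ 𝓞_H = 𝔓³`.  (If `𝔔 ∣ 𝔓` is ramified, `𝔔³ ∩ 𝓞_H = 𝔓` only.)

## Main statements

* `pow_three_injective_of_three_eq_zero`, `exists_pow_three_sub_mem_of_three_mem`,
  `sub_mem_of_pow_three_sub_pow_three_mem` — cube roots in (residue) rings of characteristic `3`;
* `pow_three_sub_pow_three_mem_pow_three` — `y ≡ ξ (mod 𝔔)`, `3 ∈ 𝔔²` ⇒ `y³ ≡ ξ³ (mod 𝔔³)`;
* `mem_pow_iff_algebraMap_mem_pow_of_ramificationIdx_eq_one` — `𝔔ⁿ ∩ A = 𝔭ⁿ` for an unramified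
  prime `𝔔 ∣ 𝔭` of an extension of Dedekind domains;
* `exists_sub_pow_three_mem_pow_three_of_ramificationIdx_eq_one`,
  `exists_sub_pow_three_mem_pow_three_of_isUnramifiedAt` — **Hecke's necessary condition**: for
  number fields `H ⊆ E`, `u ∈ 𝓞_H`, `y ∈ 𝓞_E` with `y³ = u`, a prime `𝔓` of `𝓞_H` with `3 ∈ 𝔓²`
  and a prime `𝔔 ∣ 𝔓` of `𝓞_E` unramified over `𝓞_H`: `u ≡ ξ³ (mod 𝔓³)` for some `ξ ∈ 𝓞_H`;
* `pow_sub_one_sub_one_mem_pow_three`, `sub_pow_three_mem_pow_three_of_pow_sub_one` — the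
  dictionary "`u ≡ ξ³ (mod 𝔓³)` ⟺ `u^{q−1} ≡ 1 (mod 𝔓³)`" (`q = #𝓞_H/𝔓`, `u ∉ 𝔓`), which turns
  Hecke's condition into the elementary `ε⁸ ≡ 1 (mod 9)` / `(mod 3𝔭)` spelling when `q ∣ 9`;
* `one_sub_mem_of_sq_add_add_one_eq_zero`, `not_exists_zeta_sub_pow_three_mem_pow_three` — a
  primitive cube root of unity `ζ` is NOT a cube modulo `𝔓³` when `3 ∈ 𝔓² ∖ 𝔓³` (so `H(ζ₉)/H` is
  ramified above `3`: the unit `ζ₃` never satisfies Hecke's condition — the "−1" in Scholz's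
  `s ≤ r + 1`).

## References

* E. Hecke, *Lectures on the Theory of Algebraic Numbers*, GTM 77, Springer (1981), §39 Thm 119.
  [Hecke1981]
* L. C. Washington, *Introduction to Cyclotomic Fields*, GTM 83, 2nd ed. (1997), Exercise 9.3 and the
  proof of Thm 10.10. [Washington1997]
-/

noncomputable section

open NumberField Ideal

namespace Literature.NumberTheory.NumberFields

/-! ### Cube roots in rings of characteristic `3` -/

/-- In a reduced commutative ring in which `3 = 0`, cubing is injective (`(x − y)³ = x³ − y³`).
[folklore] -/
theorem pow_three_injective_of_three_eq_zero {κ : Type*} [CommRing κ] [IsReduced κ]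
    (h3 : (3 : κ) = 0) : Function.Injective fun x : κ => x ^ 3 := by
  intro x y hxy
  simp only at hxy
  have hcube : (x - y) ^ 3 = 0 := by
    have : (x - y) ^ 3 = x ^ 3 - y ^ 3 := by
      linear_combination (x * y ^ 2 - x ^ 2 * y) * h3
    rw [this, hxy, sub_self]
  exact sub_eq_zero.mp (IsReduced.eq_zero _ ⟨3, hcube⟩)

/-- Modulo a prime ideal `P` containing `3` with finite residue ring, every element is a cube:
`∃ ξ, ξ³ ≡ u (mod P)` (cubing is injective on the finite field `R/P`, hence bijective). [folklore] -/
theorem exists_pow_three_sub_mem_of_three_mem {R : Type*} [CommRing R] (P : Ideal R) [P.IsPrime]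
    [Finite (R ⧸ P)] (h3 : (3 : R) ∈ P) (u : R) : ∃ ξ : R, ξ ^ 3 - u ∈ P := by
  have h3' : (3 : R ⧸ P) = 0 := by
    rw [← map_ofNat (Ideal.Quotient.mk P) 3]
    exact Ideal.Quotient.eq_zero_iff_mem.mpr h3
  have hinj := pow_three_injective_of_three_eq_zero (κ := R ⧸ P) h3'
  obtain ⟨c, hc⟩ := Finite.surjective_of_injective hinj (Ideal.Quotient.mk P u)
  obtain ⟨ξ, rfl⟩ := Ideal.Quotient.mk_surjective c
  refine ⟨ξ, ?_⟩
  rw [← Ideal.Quotient.eq, map_pow]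
  exact hc

/-- Modulo a prime ideal `Q` containing `3`, cube roots are unique: `y³ ≡ ξ³ (mod Q)` forces
`y ≡ ξ (mod Q)`. [folklore] -/
theorem sub_mem_of_pow_three_sub_pow_three_mem {R : Type*} [CommRing R] (Q : Ideal R) [Q.IsPrime]
    (h3 : (3 : R) ∈ Q) {y ξ : R} (h : y ^ 3 - ξ ^ 3 ∈ Q) : y - ξ ∈ Q := by
  have h3' : (3 : R ⧸ Q) = 0 := by
    rw [← map_ofNat (Ideal.Quotient.mk Q) 3]
    exact Ideal.Quotient.eq_zero_iff_mem.mpr h3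
  have hinj := pow_three_injective_of_three_eq_zero (κ := R ⧸ Q) h3'
  rw [← Ideal.Quotient.eq]
  apply hinj
  simp only [← map_pow]
  exact (Ideal.Quotient.eq).mpr h

/-! ### The cube of a congruence modulo `𝔔` holds modulo `𝔔³` when `3 ∈ 𝔔²` -/

/-- If `3 ∈ Q²` and `y ≡ ξ (mod Q)` then `y³ ≡ ξ³ (mod Q³)`:
`y³ − ξ³ = (y − ξ)³ + 3ξ(y − ξ)² + 3ξ²(y − ξ)`. [folklore] -/
theorem pow_three_sub_pow_three_mem_pow_three {R : Type*} [CommRing R] (Q : Ideal R)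
    (h3 : (3 : R) ∈ Q ^ 2) {y ξ : R} (h : y - ξ ∈ Q) : y ^ 3 - ξ ^ 3 ∈ Q ^ 3 := by
  have key : y ^ 3 - ξ ^ 3 =
      (y - ξ) ^ 3 + 3 * (y - ξ) ^ 2 * ξ + 3 * (y - ξ) * ξ ^ 2 := by ring
  rw [key]
  refine Q ^ 3 |>.add_mem (Q ^ 3 |>.add_mem (Ideal.pow_mem_pow h 3) ?_) ?_
  · refine Ideal.mul_mem_right _ _ ?_
    have h4 : 3 * (y - ξ) ^ 2 ∈ Q ^ 4 := by
      have := Ideal.mul_mem_mul h3 (Ideal.pow_mem_pow h 2)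
      rwa [← pow_add] at this
    exact Ideal.pow_le_pow_right (by norm_num) h4
  · refine Ideal.mul_mem_right _ _ ?_
    have h3' : 3 * (y - ξ) ∈ Q ^ 3 := by
      have := Ideal.mul_mem_mul h3 h
      rwa [← pow_succ] at this
    exact h3'

/-! ### Contracting powers of an unramified prime -/

section Dedekind

variable {A B : Type*} [CommRing A] [IsDedekindDomain A] [CommRing B] [IsDedekindDomain B]
  [Algebra A B] [Module.IsTorsionFree A B]

/-- **`𝔔ⁿ ∩ A = 𝔭ⁿ` for an unramified prime.**  Let `A ⊆ B` be Dedekind domains, `𝔔` a nonzero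
prime of `B` over the prime `𝔭` of `A` with ramification index `e(𝔔 ∣ 𝔭) = 1`.  Then for `x ∈ A`:
`x ∈ 𝔭ⁿ ↔ x ∈ 𝔔ⁿ` (the `𝔔`-adic valuation restricts to the `𝔭`-adic one). [folklore] -/
theorem mem_pow_iff_algebraMap_mem_pow_of_ramificationIdx_eq_one (p : Ideal A) (Q : Ideal B)
    [Q.IsPrime] [hQp : Q.LiesOver p] (hp : p ≠ ⊥) (hQ : Q ≠ ⊥)
    (he : Ideal.ramificationIdx Q A = 1) (n : ℕ) (x : A) :
    x ∈ p ^ n ↔ algebraMap A B x ∈ Q ^ n := by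
  classical
  have hpprime : p.IsPrime := Ideal.isPrime_of_liesOver Q p
  constructor
  · intro hx
    have hle : Ideal.map (algebraMap A B) (p ^ n) ≤ Q ^ n := by
      rw [Ideal.map_pow]
      exact Ideal.pow_right_mono (Ideal.map_le_iff_le_comap.mpr (le_of_eq (Q.over_def p))) n
    exact hle (Ideal.mem_map_of_mem _ hx)
  · intro hx
    by_cases hx0 : x = 0
    · simp [hx0]
    have hspan : (Ideal.span {x} : Ideal A) ≠ ⊥ := by
      simpa [Ideal.span_singleton_eq_bot] using hx0
    have hpirr : Irreducible p := (Ideal.prime_of_isPrime hp hpprime).irreducible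
    have hQirr : Irreducible Q := (Ideal.prime_of_isPrime hQ inferInstance).irreducible
    have hmul := Ideal.IsDedekindDomain.emultiplicity_map_eq_ramificationIdx'_mul
      (R := A) (S := B) hspan hpirr hQirr hQ
    rw [Ideal.ramificationIdx'_eq_ramificationIdx p Q hp, he, Nat.cast_one, one_mul,
      Ideal.map_span, Set.image_singleton] at hmul
    -- `x ∈ Q^n` says `Q^n ∣ (x)`, i.e. `n ≤ mult_Q ((x)B) = mult_p ((x))`, i.e. `p^n ∣ (x)`.
    have h1 : (n : ℕ∞) ≤ emultiplicity Q (Ideal.span {algebraMap A B x}) := by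
      rw [← pow_dvd_iff_le_emultiplicity, Ideal.dvd_span_singleton]
      exact hx
    rw [hmul] at h1
    rw [← Ideal.dvd_span_singleton, pow_dvd_iff_le_emultiplicity]
    exact h1

end Dedekind

/-! ### Hecke's necessary condition at `ℓ = 3` -/

variable {H E : Type*} [Field H] [NumberField H] [Field E] [NumberField E] [Algebra H E]

/-- **Hecke, Thm 119 (necessity, `ℓ = 3`).**  Let `H ⊆ E` be number fields, `u ∈ 𝓞_H` and
`y ∈ 𝓞_E` with `y³ = u`; let `𝔓` be a prime of `𝓞_H` with `3 ∈ 𝔓²` (e.g. any prime above `3` of a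
field containing `√−3`), and `𝔔` a prime of `𝓞_E` above `𝔓` with `e(𝔔 ∣ 𝔓) = 1`.  Then `u` is a
cube modulo `𝔓³`: `u − ξ³ ∈ 𝔓³` for some `ξ ∈ 𝓞_H`.  (Contrapositive of "if (83) is unsolvable
then `𝔩` becomes an `ℓ`th power".) [cite: Hecke1981, §39 Thm 119] -/
theorem exists_sub_pow_three_mem_pow_three_of_ramificationIdx_eq_one {u : 𝓞 H} {y : 𝓞 E}
    (hy : y ^ 3 = algebraMap (𝓞 H) (𝓞 E) u) (𝔓 : Ideal (𝓞 H)) [𝔓.IsMaximal]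
    (h3 : (3 : 𝓞 H) ∈ 𝔓 ^ 2) (𝔔 : Ideal (𝓞 E)) [𝔔.IsMaximal] [𝔔.LiesOver 𝔓]
    (he : Ideal.ramificationIdx 𝔔 (𝓞 H) = 1) : ∃ ξ : 𝓞 H, u - ξ ^ 3 ∈ 𝔓 ^ 3 := by
  classical
  -- `3 ∈ 𝔓`, so `𝔓 ≠ ⊥`, `𝔔 ≠ ⊥`, and the residue field of `𝔓` is finite of characteristic `3`.
  have h3P : (3 : 𝓞 H) ∈ 𝔓 := Ideal.pow_le_self (by norm_num) h3
  have hP0 : 𝔓 ≠ ⊥ := by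
    intro h
    rw [h, Ideal.mem_bot] at h3P
    exact (by norm_num : (3 : 𝓞 H) ≠ 0) h3P
  have hQ0 : 𝔔 ≠ ⊥ := Ideal.ne_bot_of_liesOver_of_ne_bot hP0 𝔔
  haveI : Finite (𝓞 H ⧸ 𝔓) := Ring.HasFiniteQuotients.finiteQuotient hP0
  -- a cube root of `u` modulo `𝔓`
  obtain ⟨ξ, hξ⟩ := exists_pow_three_sub_mem_of_three_mem 𝔓 h3P u
  refine ⟨ξ, ?_⟩
  -- `y ≡ ξ (mod 𝔔)` by uniqueness of cube roots modulo `𝔔`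
  have h3Q : (3 : 𝓞 E) ∈ 𝔔 := by
    have := Ideal.mem_map_of_mem (algebraMap (𝓞 H) (𝓞 E)) h3P
    rw [map_ofNat] at this
    exact (Ideal.map_le_iff_le_comap.mpr (le_of_eq (𝔔.over_def 𝔓))) this
  have h3Q2 : (3 : 𝓞 E) ∈ 𝔔 ^ 2 := by
    have := Ideal.mem_map_of_mem (algebraMap (𝓞 H) (𝓞 E)) h3
    rw [map_ofNat] at this
    have hle : Ideal.map (algebraMap (𝓞 H) (𝓞 E)) (𝔓 ^ 2) ≤ 𝔔 ^ 2 := by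
      rw [Ideal.map_pow]
      exact Ideal.pow_right_mono (Ideal.map_le_iff_le_comap.mpr (le_of_eq (𝔔.over_def 𝔓))) 2
    exact hle this
  have hyξ : y - algebraMap (𝓞 H) (𝓞 E) ξ ∈ 𝔔 := by
    apply sub_mem_of_pow_three_sub_pow_three_mem 𝔔 h3Q
    rw [hy, ← map_pow, ← map_sub]
    have hmem : u - ξ ^ 3 ∈ 𝔓 := by
      have := 𝔓.neg_mem hξ
      rwa [neg_sub] at this
    exact (Ideal.map_le_iff_le_comap.mpr (le_of_eq (𝔔.over_def 𝔓))) (Ideal.mem_map_of_mem _ hmem)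
  -- hence `u − ξ³ = y³ − ξ³ ∈ 𝔔³`, and contract to `𝔓³`
  have hcube : algebraMap (𝓞 H) (𝓞 E) (u - ξ ^ 3) ∈ 𝔔 ^ 3 := by
    rw [map_sub, map_pow, ← hy]
    exact pow_three_sub_pow_three_mem_pow_three 𝔔 h3Q2 hyξ
  haveI : 𝔔.IsPrime := inferInstance
  exact (mem_pow_iff_algebraMap_mem_pow_of_ramificationIdx_eq_one 𝔓 𝔔 hP0 hQ0 he 3 _).mpr hcube

/-- Hecke's necessary condition in the `Algebra.IsUnramifiedAt` packaging of
`KummerCubeRootUnramified.lean`: if `𝔔 ∣ 𝔓` is unramified over `𝓞_H` (`3 ∈ 𝔓²`, `y³ = u`) then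
`u ≡ ξ³ (mod 𝔓³)` for some `ξ ∈ 𝓞_H`. [cite: Hecke1981, §39 Thm 119] -/
theorem exists_sub_pow_three_mem_pow_three_of_isUnramifiedAt {u : 𝓞 H} {y : 𝓞 E}
    (hy : y ^ 3 = algebraMap (𝓞 H) (𝓞 E) u) (𝔓 : Ideal (𝓞 H)) [𝔓.IsMaximal]
    (h3 : (3 : 𝓞 H) ∈ 𝔓 ^ 2) (𝔔 : Ideal (𝓞 E)) [𝔔.IsMaximal] [𝔔.LiesOver 𝔓]
    [Algebra.IsUnramifiedAt (𝓞 H) 𝔔] : ∃ ξ : 𝓞 H, u - ξ ^ 3 ∈ 𝔓 ^ 3 :=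
  exists_sub_pow_three_mem_pow_three_of_ramificationIdx_eq_one hy 𝔓 h3 𝔔
    (Ideal.ramificationIdx_eq_one_iff.mpr inferInstance)

/-- The same with the unramifiedness hypothesis on the prime `𝔓` downstairs
(`Algebra.IsUnramifiedIn (𝓞 E) 𝔓`: every prime of `𝓞_E` above `𝔓` is unramified), using that a
prime above `𝔓` exists. [cite: Hecke1981, §39 Thm 119] -/
theorem exists_sub_pow_three_mem_pow_three_of_isUnramifiedIn {u : 𝓞 H} {y : 𝓞 E}
    (hy : y ^ 3 = algebraMap (𝓞 H) (𝓞 E) u) (𝔓 : Ideal (𝓞 H)) [𝔓.IsMaximal]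
    (h3 : (3 : 𝓞 H) ∈ 𝔓 ^ 2) (hunr : Algebra.IsUnramifiedIn (𝓞 E) 𝔓) :
    ∃ ξ : 𝓞 H, u - ξ ^ 3 ∈ 𝔓 ^ 3 := by
  obtain ⟨𝔔, h𝔔max, h𝔔over⟩ : ∃ Q : Ideal (𝓞 E), Q.IsMaximal ∧ Q.LiesOver 𝔓 :=
    Ideal.exists_maximal_ideal_liesOver_of_isIntegral 𝔓
  haveI := h𝔔max
  haveI := h𝔔over
  haveI : Algebra.IsUnramifiedAt (𝓞 H) 𝔔 := hunr 𝔔 inferInstance h𝔔over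
  exact exists_sub_pow_three_mem_pow_three_of_isUnramifiedAt hy 𝔓 h3 𝔔

/-! ### The dictionary `u ≡ ξ³ (mod 𝔓³)` ⟺ `u^{q−1} ≡ 1 (mod 𝔓³)` -/

/-- If `3 ∈ 𝔓²` and `ξ ∉ 𝔓`, with `q = #R/𝔓` finite: `ξ^{3(q−1)} ≡ 1 (mod 𝔓³)` (Fermat in the
residue field, then cube the congruence). [folklore] -/
theorem pow_three_mul_sub_one_sub_one_mem_pow_three {R : Type*} [CommRing R] (P : Ideal R)
    [P.IsMaximal] [Finite (R ⧸ P)] (h3 : (3 : R) ∈ P ^ 2) {ξ : R} (hξ : ξ ∉ P) :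
    ξ ^ (3 * (Nat.card (R ⧸ P) - 1)) - 1 ∈ P ^ 3 := by
  classical
  letI := Ideal.Quotient.field P
  haveI : Fintype (R ⧸ P) := Fintype.ofFinite _
  -- Fermat: `ξ^{q-1} ≡ 1 (mod P)`
  have hunit : (Ideal.Quotient.mk P ξ) ≠ 0 := by
    rwa [Ne, Ideal.Quotient.eq_zero_iff_mem]
  have hF : (Ideal.Quotient.mk P ξ) ^ (Nat.card (R ⧸ P) - 1) = 1 := by
    rw [Nat.card_eq_fintype_card]
    exact FiniteField.pow_card_sub_one_eq_one _ hunit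
  have hmem : ξ ^ (Nat.card (R ⧸ P) - 1) - 1 ∈ P := by
    rw [← Ideal.Quotient.eq, map_pow, map_one]
    exact hF
  have := pow_three_sub_pow_three_mem_pow_three P h3 hmem
  rwa [one_pow, ← pow_mul, mul_comm] at this

/-- **Cube modulo `𝔓³` ⇒ `(q−1)`-st power is `1` modulo `𝔓³`.**  If `3 ∈ 𝔓²`, `u ∉ 𝔓` and
`u ≡ ξ³ (mod 𝔓³)`, then `u^{q−1} ≡ 1 (mod 𝔓³)`, `q = #R/𝔓` (e.g. `u⁸ ≡ 1` when `q ∣ 9`).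
[folklore] -/
theorem pow_sub_one_sub_one_mem_pow_three {R : Type*} [CommRing R] (P : Ideal R) [P.IsMaximal]
    [Finite (R ⧸ P)] (h3 : (3 : R) ∈ P ^ 2) {u ξ : R} (hu : u ∉ P) (h : u - ξ ^ 3 ∈ P ^ 3) :
    u ^ (Nat.card (R ⧸ P) - 1) - 1 ∈ P ^ 3 := by
  have hξ : ξ ∉ P := by
    intro hξP
    apply hu
    have h1 : u - ξ ^ 3 ∈ P := Ideal.pow_le_self (by norm_num) h
    have h2 : ξ ^ 3 ∈ P := P.pow_mem_of_mem hξP 3 (by norm_num)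
    simpa using P.add_mem h1 h2
  -- `u^{q−1} − ξ^{3(q−1)} ∈ P³` since `u ≡ ξ³ (mod P³)`
  have hdiff : u ^ (Nat.card (R ⧸ P) - 1) - (ξ ^ 3) ^ (Nat.card (R ⧸ P) - 1) ∈ P ^ 3 := by
    have := Ideal.Quotient.eq.mpr h
    rw [← Ideal.Quotient.eq, map_pow, map_pow, this]
  have hF : (ξ ^ 3) ^ (Nat.card (R ⧸ P) - 1) - 1 ∈ P ^ 3 := by
    have := pow_three_mul_sub_one_sub_one_mem_pow_three P h3 hξ
    rwa [pow_mul] at this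
  have := (P ^ 3).add_mem hdiff hF
  convert this using 1
  ring

/-- **`(q−1)`-st power `1` modulo `𝔓³` ⇒ cube modulo `𝔓³`** (the converse; needs `3 ∣ q`, automatic
as `3 ∈ 𝔓`): if `u^{q−1} ≡ 1 (mod 𝔓³)` then `u ≡ (u^{q/3})³ (mod 𝔓³)`. [folklore] -/
theorem sub_pow_three_mem_pow_three_of_pow_sub_one {R : Type*} [CommRing R] (P : Ideal R)
    [P.IsMaximal] [Finite (R ⧸ P)] (h3 : (3 : R) ∈ P ^ 2) {u : R}
    (h : u ^ (Nat.card (R ⧸ P) - 1) - 1 ∈ P ^ 3) :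
    u - (u ^ (Nat.card (R ⧸ P) / 3)) ^ 3 ∈ P ^ 3 := by
  classical
  letI := Ideal.Quotient.field P
  haveI : Fintype (R ⧸ P) := Fintype.ofFinite _
  -- the residue field has characteristic `3`, so `q = 3^k` with `k ≥ 1`
  have h3P : (3 : R) ∈ P := Ideal.pow_le_self (by norm_num) h3
  haveI hchar : CharP (R ⧸ P) 3 := by
    have h30 : ((3 : ℕ) : R ⧸ P) = 0 := by
      rw [Nat.cast_ofNat, ← map_ofNat (Ideal.Quotient.mk P) 3]
      exact Ideal.Quotient.eq_zero_iff_mem.mpr h3P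
    exact (CharP.charP_iff_prime_eq_zero Nat.prime_three).mpr h30
  obtain ⟨k, hk0, hk⟩ : ∃ k : ℕ, k ≠ 0 ∧ Nat.card (R ⧸ P) = 3 ^ k := by
    obtain ⟨n, -, hn⟩ := FiniteField.card (R ⧸ P) 3
    exact ⟨n, n.ne_zero, by rw [Nat.card_eq_fintype_card]; exact hn⟩
  have hq3 : Nat.card (R ⧸ P) / 3 * 3 = Nat.card (R ⧸ P) := by
    rw [hk]
    obtain ⟨k', rfl⟩ := Nat.exists_eq_succ_of_ne_zero hk0
    rw [pow_succ, Nat.mul_div_cancel _ (by norm_num)]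
  -- `u^q − u = u (u^{q−1} − 1) ∈ P³`
  have hq1 : 1 ≤ Nat.card (R ⧸ P) := by rw [hk]; exact Nat.one_le_pow _ _ (by norm_num)
  have key : u - (u ^ (Nat.card (R ⧸ P) / 3)) ^ 3 = -(u * (u ^ (Nat.card (R ⧸ P) - 1) - 1)) := by
    rw [← pow_mul, hq3, mul_sub, mul_one, ← pow_succ', Nat.sub_add_cancel hq1]
    ring
  rw [key]
  exact (P ^ 3).neg_mem (Ideal.mul_mem_left _ _ h)

/-! ### A primitive cube root of unity is not a cube modulo `𝔓³` -/

/-- If `ζ² + ζ + 1 = 0` then `(1 − ζ)² (1 + ζ) = 3`; so for a prime `𝔓 ∋ 3`: `1 − ζ ∈ 𝔓`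
(the other factor `1 + ζ ∈ 𝔓` would give `1 = (ζ² + ζ + 1) − ζ(1 + ζ) ∈ 𝔓`). [folklore] -/
theorem one_sub_mem_of_sq_add_add_one_eq_zero {R : Type*} [CommRing R] (P : Ideal R) [P.IsPrime]
    (h3 : (3 : R) ∈ P) {ζ : R} (hζ : ζ ^ 2 + ζ + 1 = 0) : 1 - ζ ∈ P := by
  have hfac : (1 - ζ) ^ 2 * (1 + ζ) = 3 := by
    linear_combination (ζ - 2) * hζ
  have hmem : (1 - ζ) ^ 2 * (1 + ζ) ∈ P := by rw [hfac]; exact h3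
  rcases Ideal.IsPrime.mem_or_mem inferInstance hmem with h | h
  · exact Ideal.IsPrime.mem_of_pow_mem inferInstance 2 h
  · exfalso
    apply (inferInstance : P.IsPrime).ne_top
    rw [Ideal.eq_top_iff_one]
    have : (1 : R) = (ζ ^ 2 + ζ + 1) - ζ * (1 + ζ) := by ring
    rw [this]
    exact P.sub_mem (by rw [hζ]; exact P.zero_mem) (Ideal.mul_mem_left _ _ h)

/-- **`ζ₃` is not a cube modulo `𝔓³`.**  Let `𝔓` be a prime with `3 ∈ 𝔓²` but `3 ∉ 𝔓³` (i.e.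
`e(𝔓 ∣ 3) = 2`, as for every prime above `3` of `ℚ(√d, √−3)`, `3 ∤ d`… or `3 ∣ d`), and `ζ` with
`ζ² + ζ + 1 = 0`.  Then no `ξ` has `ζ ≡ ξ³ (mod 𝔓³)`: otherwise `ξ³ ≡ ζ ≡ 1 (mod 𝔓)` gives
`ξ ≡ 1 (mod 𝔓)`, hence `ξ³ ≡ 1 (mod 𝔓³)` and `1 − ζ ∈ 𝔓³`; but `(1 − ζ)²(1 + ζ) = 3 ∉ 𝔓³`.  By
Hecke's necessity this is why `H(∛ζ₃) = H(ζ₉)` is ramified above `3`, the source of the defect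
`s − r ≤ 1` in Scholz's reflection theorem. [cite: Washington1997, proof of Thm 10.10] -/
theorem not_exists_zeta_sub_pow_three_mem_pow_three {R : Type*} [CommRing R] (P : Ideal R)
    [P.IsPrime] (h3 : (3 : R) ∈ P ^ 2) (h3' : (3 : R) ∉ P ^ 3) {ζ : R}
    (hζ : ζ ^ 2 + ζ + 1 = 0) : ¬ ∃ ξ : R, ζ - ξ ^ 3 ∈ P ^ 3 := by
  rintro ⟨ξ, hξ⟩
  have h3P : (3 : R) ∈ P := Ideal.pow_le_self (by norm_num) h3
  have h1ζ : 1 - ζ ∈ P := one_sub_mem_of_sq_add_add_one_eq_zero P h3P hζ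
  -- `ξ³ ≡ 1 (mod P)`, hence `ξ ≡ 1 (mod P)`
  have hξ1 : ξ - 1 ∈ P := by
    apply sub_mem_of_pow_three_sub_pow_three_mem P h3P
    rw [one_pow]
    have h1 : ζ - ξ ^ 3 ∈ P := Ideal.pow_le_self (by norm_num) hξ
    have : ξ ^ 3 - 1 = -(ζ - ξ ^ 3) - (1 - ζ) := by ring
    rw [this]
    exact P.sub_mem (P.neg_mem h1) h1ζ
  -- hence `ξ³ ≡ 1 (mod P³)` and `1 − ζ ∈ P³`
  have hξ3 : ξ ^ 3 - 1 ^ 3 ∈ P ^ 3 := pow_three_sub_pow_three_mem_pow_three P h3 hξ1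
  have h1ζ3 : 1 - ζ ∈ P ^ 3 := by
    have : 1 - ζ = -(ζ - ξ ^ 3) - (ξ ^ 3 - 1 ^ 3) := by ring
    rw [this]
    exact (P ^ 3).sub_mem ((P ^ 3).neg_mem hξ) hξ3
  apply h3'
  have hfac : (3 : R) = (1 - ζ) * ((1 - ζ) * (1 + ζ)) := by
    linear_combination (-(ζ - 2)) * hζ
  rw [hfac]
  exact Ideal.mul_mem_right _ _ h1ζ3

end Literature.NumberTheory.NumberFields

end
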